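import Summits.QuantumFields.YangMills.Theorems.ConvexGribovBodyBrascampLiebVacuumSCStubCubeGlue
import Summits.QuantumFields.YangMills.Theorems.ConvexGribovBodyBrascampLiebVacuumSCCubeWitnessCentral
import Summits.QuantumFields.YangMills.Theorems.ConvexGribovBodyBrascampLiebVacuumSCCubeWitnessOfDimensionGap
import Summits.QuantumFields.YangMills.Theorems.ConvexGribovBodyBrascampLiebVacuumSCStubCartanChart
import Summits.QuantumFields.YangMills.Theorems.ConvexGribovBodyBrascampLiebVacuumSCStubEuclidBalls
import Summits.QuantumFields.YangMills.Theorems.ConvexGribovBodyBrascampLiebVacuumSCStubHaarSandwich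
import Summits.QuantumFields.YangMills.Theorems.ConvexGribovBodyBrascampLiebVacuumSCStubExpLocal
import Summits.QuantumFields.YangMills.Theorems.ConvexGribovBodyBrascampLiebVacuumSCStubGapAssembly
import Summits.QuantumFields.YangMills.Theorems.ConvexGribovBodyBrascampLiebVacuumSCStubLieSimple
import Summits.QuantumFields.YangMills.Theorems.ConvexGribovBodyBrascampLiebVacuumSCStubWeightDecomp
import Summits.QuantumFields.YangMills.Theorems.ConvexGribovBodyBrascampLiebVacuumSCStubAbelianThird
import Summits.QuantumFields.YangMills.Theorems.ConvexGribovBodyBrascampLiebVacuumSCStubInvolutionSplit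
import Summits.QuantumFields.YangMills.Theorems.ConvexGribovBodyBrascampLiebVacuumSCStubInvolutionGlue
import Summits.QuantumFields.YangMills.Theorems.ConvexGribovBodyBrascampLiebVacuumSCStubRankOneCentral
import Literature.MathematicalPhysics.QuantumLattice.RepLieAlgebra
import Mathlib.Analysis.Normed.Algebra.MatrixExponential
import Mathlib.Analysis.SpecialFunctions.Exponential

/-!
# The volume-uniform Coulomb-gauge floor for every simply-connected compact simple gauge group
# (crux `BrascampLiebVacuumSC`, stmt-QuantumFields-16404, route `ConvexGribovBody`, line `SketchIdeator1`)

Lead c4 (`prover-line-stmt-QuantumFields-16404-c4-0`), 2026-08-17. This file assembles the 25 landed stubs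
of the line (leads 0, c1, c2, c3, c4 and their workers) into the floor side of the crux, sorry-free and
without named facts:

* `involutionDim` — for a simply-connected compact simple `G` with faithful unitary `ρ` and every
  NON-CENTRAL involution `j`: `3 · dim_ℝ (𝔥 ∩ 𝔭_j) < 2 · dim_ℝ 𝔥`, `𝔥` the matrix Lie algebra of `ρ(G)`,
  `𝔭_j = {X : Ad_{ρ j} X = −X}`. Classification-free: ideals of `𝔥` are trivial (`stub_lieSimple`, from
  `IsSimpleCompactGroup`), joint weight decomposition of `𝔥_ℂ = 𝔥 ⊕ i𝔥` under an abelian `A ≤ 𝔥`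
  (`stub_weightDecomp`), `3·dim A < dim 𝔥` for abelian `A` when `dim 𝔥 > 3` (`stub_abelianThird`: root
  count `dim 𝔥 ≥ dim A + |Φ| ≥ 3 dim A`, equality excluded by the ideal `E_β ⊔ E_{−β} ⊔ [E_β, E_{−β}]`),
  `dim 𝔭 ≤ dim 𝔨 + dim 𝔞` (`stub_involutionSplit`, restricted roots via the swap `θ E_w = E_{−w}`), the
  glue `stub_involutionGlue`, and the rank-one case `stub_rankOneCentral` (`dim 𝔥 ≤ 3` + simply connected
  ⇒ involutions central, by path lifting through `S³ → SO(3)` — the ONLY use of `SimplyConnectedSpace`;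
  false for `SO(3)`).
* `dimensionGap` — the Haar dimension gap: ball growth `c ε^d ≤ μ{‖ρ g − 1‖_F < ε}`, thin involutions
  `μ{g : ∃ j, j² = 1, ‖ρ g − ρ j‖_F < ε} ≤ C ε^m`, `d < 3m` (metric entropy: Cartan's exponential chart
  `stub_cartanChart`, Euclidean nets `stub_euclidBalls`, the Haar sandwich `stub_haarSandwich`, local
  bi-Lipschitz `exp` and rigidity of near-involutions `stub_expLocal`, assembled by `stub_gapAssembly`).
* `cubeWitness` — some configuration of the `n × n × n` cube is not gauge-equivalent to an
  involution-valued one (`stub_cubeWitness_of_dimensionGap`, Tonelli volume counting).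
* `floorCore` — **the floor**: for every `β` there are `d(β) > 0` and `S₀` with
  `d ≤ ∫ sup_{h ∈ argmin coul(U,·)} L⁻³ Σ_{j,y} ‖A^h_j(y)‖²_F dμ_{β,S}` on all tori `S ≥ S₀`
  (`stub_cubeGlue`: cube orbit functional, block freeing against the Boltzmann factor). This is the
  disprover's sub-crux `CoulombGaugeAFloor r` (`Cruxes/BrascampLiebVacuumSC/Disproof.lean`, finding G6) —
  its necessity for the crux is `Negative/DmaxFloorOfProbe`; here it is PROVED, which closes the
  "`Dmax` degeneration" refutation lever for simply-connected `G` for good.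

With these, the line's skeleton (`Cruxes/BrascampLiebVacuumSC/Lines/SketchIdeator1.lean`, v8.2) closes the
crux BY NAME modulo ONE stub, the uniform heat-bath Poincaré inequality UP(β ≥ β₀) for simply-connected `G`
(= route FradkinShenkerFlow's `FiniteSusceptibilityWeakCoupling ∧ SusceptibilityToPoincare`,
stmt-QuantumFields-9442 ∧ 9441 — the open problem).
-/

open scoped BigOperators Topology Matrix
open Filter MeasureTheory ProbabilityTheory
open Literature.MathematicalPhysics.QuantumFieldTheory Literature.MathematicalPhysics.QuantumLattice
open Summit.QuantumFields.YangMills.Cruxes.CovarianceBound.SupportWindow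
  (froSq coulombF IsCoulMin gluon wilson4)

noncomputable section

namespace Summit.QuantumFields.YangMills.Theorems.BrascampLiebVacuumSC

/-- **F2 — involution eigenspaces are small.** For a simply-connected compact simple `G` with faithful
unitary `ρ` and every involution `j ∉ Z(G)`: `3 · dim_ℝ (𝔥 ∩ 𝔭_j) < 2 · dim_ℝ 𝔥`, where
`𝔥 = {X : exp(tX) ∈ ρ(G) ∀ t}` is the matrix Lie algebra of `ρ(G)` and `𝔭_j = {X : ρ j * X * ρ j = −X}`
(classically `dim 𝔭 < (2/3) dim 𝔤` for every symmetric pair of a compact simple `𝔤`, Helgason Ch. X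
Table V; here classification-free, see the file docstring). [folklore] -/
theorem involutionDim :
    ∀ (G : Type) [Group G] [TopologicalSpace G] [IsTopologicalGroup G] [CompactSpace G]
    [MeasurableSpace G] [BorelSpace G], IsCompactSimpleLieGroup G → SimplyConnectedSpace G →
    ∀ (r : LatticeRep G) (j : G), j * j = 1 → j ∉ Subgroup.center G →
      3 * Module.finrank ℝ ↥(Submodule.span ℝ
            ({X : Matrix (Fin r.N) (Fin r.N) ℂ | ∀ t : ℝ, NormedSpace.exp (t • X) ∈ Set.range r.ρ} ∩
              {X | r.ρ j * X * r.ρ j = -X})) <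
        2 * Module.finrank ℝ ↥(Submodule.span ℝ
            {X : Matrix (Fin r.N) (Fin r.N) ℂ | ∀ t : ℝ, NormedSpace.exp (t • X) ∈ Set.range r.ρ}) :=
  stub_involutionGlue stub_lieSimple stub_weightDecomp stub_abelianThird stub_involutionSplit
    stub_rankOneCentral

/-- **The Haar dimension gap.** For a simply-connected compact simple `G` and a faithful unitary `r` there
are exponents `d < 3m` and constants with, for the Haar probability measure `μ` and the Frobenius distance
pulled back by `r.ρ`, BALL GROWTH `c ε^d ≤ μ{g : ‖ρ g − 1‖²_F < ε²}` and THIN INVOLUTIONS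
`μ{g : ∃ j, j² = 1, ‖ρ g − ρ j‖²_F < ε²} ≤ C ε^m` for `0 < ε ≤ ε₀` (`d = dim G`, `m = dim G − dim J_max`).
Metric entropy (`stub_cartanChart`, `stub_euclidBalls`, `stub_haarSandwich`, `stub_expLocal`,
`stub_gapAssembly`) + `involutionDim`. [folklore] -/
theorem dimensionGap :
    ∀ (G : Type) [Group G] [TopologicalSpace G] [IsTopologicalGroup G] [CompactSpace G]
    [MeasurableSpace G] [BorelSpace G], IsCompactSimpleLieGroup G → SimplyConnectedSpace G →
    ∀ r : LatticeRep G, ∃ (d m : ℕ) (c C ε₀ : ℝ), d < 3 * m ∧ 0 < c ∧ 0 < ε₀ ∧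
      (∀ ε : ℝ, 0 < ε → ε ≤ ε₀ →
        c * ε ^ d ≤ (haarProbability G {g : G | froSq (r.ρ g - 1) < ε ^ 2}).toReal) ∧
      (∀ ε : ℝ, 0 < ε → ε ≤ ε₀ →
        (haarProbability G {g : G | ∃ j : G, j * j = 1 ∧ froSq (r.ρ g - r.ρ j) < ε ^ 2}).toReal
          ≤ C * ε ^ m) := by
  intro G _ _ _ _ _ _ hG hSC r
  obtain ⟨V, hVcar, hchart⟩ := stub_cartanChart G r
  exact stub_gapAssembly G hG r V hVcar hchart
    (fun j hj hjc => involutionDim G hG hSC r j hj hjc)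
    (fun W s hs => stub_euclidBalls r.N W s hs)
    (fun ε T hε => stub_haarSandwich G r ε T hε)
    (stub_expLocal r.N)

/-- **The cube witness.** For a simply-connected compact simple `G` (with a faithful `r` and its Borel/Haar
structure in context) there are `n` and a configuration `u` of the `n × n × n` cube (sites `Fin 3 → Fin n`,
links `(x, j)` with `x j + 1 < n`, from `x` to `x + e_j`) that NO gauge transformation `k` of the cube makes
involution-valued: for every `k` some link value `v = k(x) u(x,j) k(x + e_j)⁻¹` has `v² ≠ 1`
(`dimensionGap` + Tonelli volume counting `stub_cubeWitness_of_dimensionGap`). [folklore] -/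
theorem cubeWitness (G : Type) [Group G] [TopologicalSpace G] [IsTopologicalGroup G] [CompactSpace G]
    [MeasurableSpace G] [BorelSpace G] (hG : IsCompactSimpleLieGroup G) (hSC : SimplyConnectedSpace G)
    (r : LatticeRep G) :
    ∃ (n : ℕ) (u : (Fin 3 → Fin n) → Fin 3 → G), ∀ k : (Fin 3 → Fin n) → G,
      ∃ (x : Fin 3 → Fin n) (j : Fin 3) (h : (x j : ℕ) + 1 < n),
        k x * u x j * (k (Function.update x j ⟨(x j : ℕ) + 1, h⟩))⁻¹ *
          (k x * u x j * (k (Function.update x j ⟨(x j : ℕ) + 1, h⟩))⁻¹) ≠ 1 := by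
  obtain ⟨d, m, c, C, ε₀, hdm, hc, hε₀, hball, hthin⟩ := dimensionGap G hG hSC r
  exact stub_cubeWitness_of_dimensionGap G r d m c C ε₀ hdm hc hε₀ hball hthin

/-- **The volume-uniform floor of the minimal-Coulomb-gauge `A`-field mass** (the disprover's sub-crux
`CoulombGaugeAFloor r` for simply-connected `G`). For a simply-connected compact simple `G`, a faithful
unitary `r` and EVERY `β` there are `d > 0` and `S₀` with, on all tori `(2S+1)⁴`, `S ≥ S₀`:
`d ≤ ∫ sup_{h ∈ argmin coul(U,·)} L⁻³ Σ_{j,y} ‖A^h_j(y)‖²_F dμ_{β,S}(U)`, `A^h_j(y) = ½(ρ(v) − ρ(v)ᴴ)` the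
anti-Hermitian part of the gauge-fixed spatial link `v` at time zero (`cubeWitness` + `stub_cubeGlue`:
the cube orbit functional freed against the Boltzmann factor; `S₀ = n`, the cube side). [folklore] -/
theorem floorCore : ∀ (G : Type) [Group G] [TopologicalSpace G] [IsTopologicalGroup G] [CompactSpace G] [MeasurableSpace G] [BorelSpace G], IsCompactSimpleLieGroup G → SimplyConnectedSpace G → ∀ (r : LatticeRep G) (β : ℝ), ∃ d : ℝ, 0 < d ∧ ∃ S₀ : ℕ, ∀ S : ℕ, S₀ ≤ S → d ≤ ∫ U, (⨆ h : {h : Site 4 (2 * S + 1) → G // IsCoulMin r S U h}, (∑ j : Fin 3, ∑ y : Fin 3 → ZMod (2 * S + 1), froSq (gluon r S U h.1 y j)) / ((2 * S + 1 : ℝ) ^ 3)) ∂(wilson4 r β S) := by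
  intro G _ _ _ _ _ _ hG hSC r β
  obtain ⟨n, u, hu⟩ := cubeWitness G hG hSC r
  obtain ⟨d, hd, hS⟩ := stub_cubeGlue G r β n u hu
  exact ⟨d, hd, n, hS⟩

/-- **`CoulombGaugeAFloor r` holds for every simply-connected compact simple `G`** — `floorCore` in the
VERBATIM shape of the disprover's sub-crux `Cruxes/BrascampLiebVacuumSC/Disproof.lean: CoulombGaugeAFloor`
(inline `let`s; `β₀ := 0`, i.e. at every `β`): `a ≤ L⁻³ · ∫ sup_{h ∈ argmin coul(U,·)} Σ_{j,y} ‖A^h_j(y)‖²_F dμ`.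
The two shapes differ only by `∫ (sup Σ)/L³ = L⁻³ ∫ sup Σ` (`Real.iSup_mul_of_nonneg`, `integral_mul_const`).
[folklore] -/
theorem coulombGaugeAFloorSC (G : Type) [Group G] [TopologicalSpace G] [IsTopologicalGroup G]
    [CompactSpace G] [MeasurableSpace G] [BorelSpace G] (hG : IsCompactSimpleLieGroup G)
    (hSC : SimplyConnectedSpace G) (r : LatticeRep G) :
    ∃ β₀ : ℝ, ∀ β : ℝ, β₀ ≤ β → ∃ a : ℝ, 0 < a ∧ ∃ S₀ : ℕ, ∀ S : ℕ, S₀ ≤ S →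
    let fro : Matrix (Fin r.N) (Fin r.N) ℂ → ℝ := fun M => ∑ a, ∑ b, ‖M a b‖ ^ 2
    let Amass : GaugeConfig 4 (2 * S + 1) G → (Site 4 (2 * S + 1) → G) → ℝ := fun U h =>
      ∑ j : Fin 3, ∑ y : Fin 3 → ZMod (2 * S + 1),
        fro ((1 / 2 : ℂ) • (r.ρ (gaugeTransform h U (Fin.cons (0 : ZMod (2 * S + 1)) y, j.succ)) -
          (r.ρ (gaugeTransform h U (Fin.cons (0 : ZMod (2 * S + 1)) y, j.succ)))ᴴ))
    let μ := wilsonMeasure (d := 4) (L := 2 * S + 1) r.ρ β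
    let coul : GaugeConfig 4 (2 * S + 1) G → (Site 4 (2 * S + 1) → G) → ℝ := fun U h =>
      -∑ e : Edge 4 (2 * S + 1),
        (if e.1 0 = 0 ∧ e.2 ≠ 0 then (r.ρ (gaugeTransform h U e)).trace.re else 0)
    a ≤ (1 / (2 * S + 1 : ℝ) ^ 3) *
      ∫ U, (⨆ h : {h : Site 4 (2 * S + 1) → G // ∀ h', coul U h ≤ coul U h'}, Amass U h.1) ∂μ := by
  refine ⟨0, fun β _ => ?_⟩
  obtain ⟨d, hd, S₀, hS⟩ := floorCore G hG hSC r β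
  refine ⟨d, hd, S₀, fun S hSle => ?_⟩
  intro fro Amass μ coul
  have h := hS S hSle
  have hc : (0 : ℝ) ≤ ((2 * S + 1 : ℝ) ^ 3)⁻¹ := by positivity
  have key : ∀ U : GaugeConfig 4 (2 * S + 1) G,
      (⨆ h : {h : Site 4 (2 * S + 1) → G // IsCoulMin r S U h},
        (∑ j : Fin 3, ∑ y : Fin 3 → ZMod (2 * S + 1), froSq (gluon r S U h.1 y j)) /
          ((2 * S + 1 : ℝ) ^ 3)) =
      (⨆ h : {h : Site 4 (2 * S + 1) → G // ∀ h', coul U h ≤ coul U h'}, Amass U h.1) *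
        ((2 * S + 1 : ℝ) ^ 3)⁻¹ := by
    intro U
    rw [Real.iSup_mul_of_nonneg hc]
    rfl
  simp_rw [key, integral_mul_const] at h
  rw [one_div, mul_comm]
  exact h

end Summit.QuantumFields.YangMills.Theorems.BrascampLiebVacuumSC

end
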